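import Summits.BirchSwinnertonDyer.BirchSwinnertonDyer.Theorems.SchneiderFreeAdditiveX3PoitouTateBidualTransport
import HarnessLib

/-!
# Poitou–Tate toolkit: Milne I Thm. 4.10(b) `Ker γ¹ ⊆ Im β¹` for `M` FOLLOWS from the same statement
# for `M^D` — the duality symmetry of the basic middle exactness (double annihilator in the perfect
# finite pairing `⊕_{v∈S} H¹(K_v, M) × ⊕_{v∈S} H¹(K_v, M^D) → ℤ/n`)

Cell `bsd-schneider-ideate`, seat `bsd-schneider-door-c6` (prover, generation 7).  PARTITION: board row
B6 ∩ X3 ∩ sst-twist, `r = 1` — CONTROL corner (crux `AnticycControlAdditiveK`, stmt-BirchSwinnertonDyer-19295,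
support-record; registered stubs `stub_baseCountTors` / `stub_ptSurj` hinge on the hypothesis `hE` =
Milne *ADT* I Thm. 4.10(b) for `LocalInvariants.canonical K (p^k)`, ALL finite `M`, through
`poitouTate_selmerStructure_duality_of_middleExact_canonical_primePow`).  THEOREMS ONLY.  HONEST FRAMING:
no new case of Poitou–Tate is proved here by itself and no case of BSD; this file HALVES the statement:
for every finite `n`-torsion `M` and every admissible `S`, `hE(M, S)` follows from `hE(M^D, S)`.

* §1 **`middleExact_of_dualMiddleExact`** — for a family `inv` perfect at the finite places and injective at
  the real places: the DUAL basic exactness `hE'(M, S)` (a family `u ∈ ⊕_{v∈S} H¹(K_v, M^D)` orthogonal to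
  `loc(H¹_S(K, M))` is `loc` of a class of `H¹_S(K, M^D)`) implies `hE(M, S)`.  Mechanism: in the perfect
  pairing `b` of the finite groups `A = ⊕_{v∈S} H¹(K_v, M)`, `B = ⊕_{v∈S} H¹(K_v, M^D)`, write
  `L = loc(H¹_S(K, M)) ≤ A`, `L^D = loc(H¹_S(K, M^D)) ≤ B`; `hE'` says `L^⊥ ≤ L^D`, hence
  `{}^⊥(L^D) ≤ {}^⊥(L^⊥) = L` (double annihilator, Milne I Prop. 0.19), which is `hE`.
* §2 **`middleExact_of_middleExact_tateDual`** — `hE(M^D, S) → hE(M, S)` (same `S`): `hE(M^D, S)` is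
  `hE'(M, S)` read through biduality `M ≅ M^{DD}` and `⟨u, ι x⟩' = -⟨x, u⟩`
  (`exists_bidual_intertwining`, `localTatePairingZMod_tateDual_map_bidual`, p484492), then §1.
* §3 the same two statements for THE invariant maps `LocalInvariants.canonical K n` of a `K : Type`
  (`IsPerfect` = `canonical_isPerfect`, `InjectiveAtRealPlaces` = `canonical_injectiveAtRealPlaces`).

Consequence (next file): with door-c6 g6's `middleExact_mu` (`M = μₚ`), Milne I 4.10(b) for `M = μₚ^D ≅ ℤ/p`.

References: [MilneADT2006] I Prop. 0.19, Cor. 2.3, Thm. 2.13 (a), Thm. 4.10 (b);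
[NeukirchSchmidtWingberg2008] I §4 (1.4.4); [Howard2004HeegnerKolyvagin] Thm. 2.1.11 (arXiv:1202.6340 p. 6).
-/

noncomputable section

open Function NumberField IsDedekindDomain CategoryTheory
open scoped NumberField ContRepresentation

universe u

set_option linter.dupNamespace false
set_option autoImplicit false

namespace Summit.BirchSwinnertonDyer.BirchSwinnertonDyer.Theorems.SchneiderFreeAdditiveX3.PoitouTateReduction

open Field
open Literature.NumberTheory.GaloisRepresentations Literature.NumberTheory.GaloisCohomology
open Literature.NumberTheory.GaloisRepresentations.DiscreteGaloisModule (mu MuCarrier TateDual tateDual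
  tateDualEval tateDualPairingLocal localTatePairing localTatePairingZMod unramifiedSubgroup SelmerStructure)
open Summit.BirchSwinnertonDyer.Rank1Residual.X11b
open Summit.BirchSwinnertonDyer.Rank1Residual.X11b.FiniteDuality

/-! ## §1. The dual basic exactness implies the basic exactness -/

section DualToPrimal

variable {K : Type u} [Field K] [NumberField K] {n : ℕ} [NeZero n]
variable {M : Type u} [AddCommGroup M] [TopologicalSpace M] [DiscreteTopology M] [Finite M]

/-- **Milne I Thm. 4.10(b) `Ker γ¹ ⊆ Im β¹` for `(M, S)` from its DUAL form for `(M, S)`.**  For a family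
`inv` of local invariant maps perfect at the finite places and injective at the real places, a finite
`n`-torsion `M` and a finite set of places `S`: if every family `u ∈ ⊕_{v∈S} H¹(K_v, M^D)` with
`∑_{v∈S} ⟨x_v, u_v⟩_v = 0` for all `x ∈ H¹(K, M)` unramified outside `S` is the localisation on `S` of a
class of `H¹(K, M^D)` unramified outside `S` (hypothesis `hE'`), then every family
`t ∈ ⊕_{v∈S} H¹(K_v, M)` with `∑_{v∈S} ⟨t_v, y_v⟩_v = 0` for all `y ∈ H¹(K, M^D)` unramified outside `S`
is the localisation on `S` of a class of `H¹(K, M)` unramified outside `S`.  Proof: in the perfect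
pairing of the finite groups `⊕_{v∈S} H¹(K_v, M) × ⊕_{v∈S} H¹(K_v, M^D) → ℤ/n` (local Tate duality at
every place of `S`), `hE'` reads `L^⊥ ≤ L^D` for `L = loc(H¹_S(K, M))`, `L^D = loc(H¹_S(K, M^D))`; so
`{}^⊥(L^D) ≤ {}^⊥(L^⊥) = L` by the double annihilator (Milne I Prop. 0.19).
[cite: MilneADT2006, Ch. I, Thm. 4.10(b) and Prop. 0.19] -/
theorem middleExact_of_dualMiddleExact (inv : LocalInvariants K n) (hperf : inv.IsPerfect)
    (hreal : inv.InjectiveAtRealPlaces) (ρ : DiscreteGaloisModule K M) (hM : ∀ m : M, n • m = 0)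
    {S : Finset (Place K)}
    (hE' : ∀ u : Π v : Place K, galoisCohomology ((ρ.tateDual n).toLocal v) 1,
      (∀ x : galoisCohomology ρ 1,
        (∀ v : HeightOneSpectrum (𝓞 K), (Sum.inr v : Place K) ∉ S →
          galoisCohomology.localization ρ (Sum.inr v) 1 x ∈ unramifiedSubgroup (GaloisRep.toLocal v ρ) 1) →
        ∑ v ∈ S, localTatePairingZMod ρ n v (inv v) (galoisCohomology.localization ρ v 1 x) (u v) = 0) →
      ∃ y : galoisCohomology (ρ.tateDual n) 1,
        (∀ v : HeightOneSpectrum (𝓞 K), (Sum.inr v : Place K) ∉ S →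
          galoisCohomology.localization (ρ.tateDual n) (Sum.inr v) 1 y ∈
            unramifiedSubgroup (GaloisRep.toLocal v (ρ.tateDual n)) 1) ∧
        ∀ v ∈ S, galoisCohomology.localization (ρ.tateDual n) v 1 y = u v)
    (t : Π v : Place K, galoisCohomology (ρ.toLocal v) 1)
    (horth : ∀ y : galoisCohomology (ρ.tateDual n) 1,
      (∀ v : HeightOneSpectrum (𝓞 K), (Sum.inr v : Place K) ∉ S →
        galoisCohomology.localization (ρ.tateDual n) (Sum.inr v) 1 y ∈
          unramifiedSubgroup (GaloisRep.toLocal v (ρ.tateDual n)) 1) →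
      ∑ v ∈ S, localTatePairingZMod ρ n v (inv v) (t v)
        (galoisCohomology.localization (ρ.tateDual n) v 1 y) = 0) :
    ∃ x : galoisCohomology ρ 1,
      (∀ v : HeightOneSpectrum (𝓞 K), (Sum.inr v : Place K) ∉ S →
        galoisCohomology.localization ρ (Sum.inr v) 1 x ∈ unramifiedSubgroup (GaloisRep.toLocal v ρ) 1) ∧
      ∀ v ∈ S, galoisCohomology.localization ρ v 1 x = t v := by
  classical
  -- finiteness and `n`-torsion of the local groups over `S`
  haveI : ∀ i : ↥S, Finite (galoisCohomology (ρ.toLocal (i : Place K)) 1) := fun i =>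
    finite_galoisCohomology_one_toLocal_place ρ i
  haveI : ∀ i : ↥S, Finite (galoisCohomology ((ρ.tateDual n).toLocal (i : Place K)) 1) := fun i =>
    finite_galoisCohomology_one_tateDual_toLocal_place ρ i
  have hAn : ∀ p : Π i : ↥S, galoisCohomology (ρ.toLocal (i : Place K)) 1, n • p = 0 :=
    pi_nsmul_eq_zero fun i x => galoisCohomology.nsmul_eq_zero_of_forall _ hM x
  have hBn : ∀ q : Π i : ↥S, galoisCohomology ((ρ.tateDual n).toLocal (i : Place K)) 1, n • q = 0 :=
    pi_nsmul_eq_zero fun i y => galoisCohomology.nsmul_eq_zero_of_forall _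
      (fun f => DiscreteGaloisModule.TateDual.nsmul_eq_zero f) y
  -- the sum pairing over `S` and its perfectness
  obtain ⟨b, hb⟩ := exists_piPairing
    (fun i : ↥S => localTatePairingZMod ρ n (i : Place K) (inv (i : Place K)))
  have hloc := fun i : ↥S => bijective_localTatePairingZMod_place inv hperf hreal ρ hM (i : Place K)
  obtain ⟨hbij, hbijflip⟩ := AddMonoidHom.bijective_of_injective_of_injective_flip hAn hBn b
    (piPairing_injective hb fun i => (hloc i).1.1) (piPairing_flip_injective hb fun i => (hloc i).2.1)
  -- localisation to `S`
  let locS : galoisCohomology ρ 1 →+ Π i : ↥S, galoisCohomology (ρ.toLocal (i : Place K)) 1 :=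
    AddMonoidHom.pi fun i : ↥S => galoisCohomology.localization ρ (i : Place K) 1
  let locSD : galoisCohomology (ρ.tateDual n) 1 →+
      Π i : ↥S, galoisCohomology ((ρ.tateDual n).toLocal (i : Place K)) 1 :=
    AddMonoidHom.pi fun i : ↥S => galoisCohomology.localization (ρ.tateDual n) (i : Place K) 1
  -- classes unramified outside `S`
  let HS : AddSubgroup (galoisCohomology ρ 1) :=
    ⨅ (v : HeightOneSpectrum (𝓞 K)) (_ : (Sum.inr v : Place K) ∉ S),
      (unramifiedSubgroup (GaloisRep.toLocal v ρ) 1).comap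
        (galoisCohomology.localization ρ (Sum.inr v) 1)
  let HSD : AddSubgroup (galoisCohomology (ρ.tateDual n) 1) :=
    ⨅ (v : HeightOneSpectrum (𝓞 K)) (_ : (Sum.inr v : Place K) ∉ S),
      (unramifiedSubgroup (GaloisRep.toLocal v (ρ.tateDual n)) 1).comap
        (galoisCohomology.localization (ρ.tateDual n) (Sum.inr v) 1)
  have memHS : ∀ x, x ∈ HS ↔ ∀ v : HeightOneSpectrum (𝓞 K), (Sum.inr v : Place K) ∉ S →
      galoisCohomology.localization ρ (Sum.inr v) 1 x ∈ unramifiedSubgroup (GaloisRep.toLocal v ρ) 1 :=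
    fun x => by simp only [HS, AddSubgroup.mem_iInf, AddSubgroup.mem_comap]; exact Iff.rfl
  have memHSD : ∀ y, y ∈ HSD ↔ ∀ v : HeightOneSpectrum (𝓞 K), (Sum.inr v : Place K) ∉ S →
      galoisCohomology.localization (ρ.tateDual n) (Sum.inr v) 1 y ∈
        unramifiedSubgroup (GaloisRep.toLocal v (ρ.tateDual n)) 1 :=
    fun y => by simp only [HSD, AddSubgroup.mem_iInf, AddSubgroup.mem_comap]; exact Iff.rfl
  -- `hE'`: `L^⊥ ≤ L^D`
  have h1 : annRight b (HS.map locS) ≤ HSD.map locSD := by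
    intro q hq
    let u₀ : Π v : Place K, galoisCohomology ((ρ.tateDual n).toLocal v) 1 := fun v =>
      if h : v ∈ S then q ⟨v, h⟩ else 0
    have hu₀ : ∀ i : ↥S, u₀ i = q i := fun i => by
      simp only [u₀, dif_pos i.2]
    obtain ⟨y, hyur, hyS⟩ := hE' u₀ fun x hx => by
      have hp : locS x ∈ HS.map locS := AddSubgroup.mem_map_of_mem _ ((memHS x).2 hx)
      have h0 := (mem_annRight_iff b _ q).1 hq _ hp
      rw [hb] at h0
      rw [← Finset.sum_coe_sort]
      refine Eq.trans (Finset.sum_congr rfl fun i _ => ?_) h0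
      rw [hu₀ i]
      rfl
    refine ⟨y, (memHSD y).2 hyur, funext fun i => ?_⟩
    rw [AddMonoidHom.pi_apply, hyS i i.2, hu₀ i]
  -- hence `{}^⊥(L^D) ≤ {}^⊥(L^⊥) = L`
  have h2 : annLeft b (HSD.map locSD) ≤ HS.map locS :=
    (annLeft_anti b h1).trans (le_of_eq (annLeft_annRight hAn hBn b hbij hbijflip _))
  -- `t|_S ∈ {}^⊥(L^D)`
  have ht : (fun i : ↥S => t i) ∈ annLeft b (HSD.map locSD) := by
    rw [mem_annLeft_iff]
    intro q hq
    obtain ⟨y, hy, rfl⟩ := AddSubgroup.mem_map.1 hq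
    have h0 := horth y ((memHSD y).1 hy)
    rw [← Finset.sum_coe_sort S] at h0
    rw [hb]
    exact h0
  obtain ⟨x, hx, hxt⟩ := AddSubgroup.mem_map.1 (h2 ht)
  refine ⟨x, (memHS x).1 hx, fun v hv => ?_⟩
  have h3 := congr_fun hxt ⟨v, hv⟩
  rwa [AddMonoidHom.pi_apply] at h3

end DualToPrimal

/-! ## §2. `hE(M^D, S) ⟹ hE(M, S)` -/

section TateDualToPrimal

variable {K : Type u} [Field K] [NumberField K] {n : ℕ} [NeZero n]
variable {M : Type u} [AddCommGroup M] [TopologicalSpace M] [DiscreteTopology M] [Finite M]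

/-- **Milne I Thm. 4.10(b) `Ker γ¹ ⊆ Im β¹` for `(M, S)` from the same statement for `(M^D, S)`** (a
family `inv` perfect at the finite places and injective at the real places; `M` finite `n`-torsion; any
finite set of places `S`).  The statement for `M^D` (hypothesis `hED`, literally the `hE`-shape for the
module `ρ.tateDual n` and the SAME `S`) is the dual basic exactness for `M` read through biduality
`M ≅ M^{DD}` and `⟨u_v, (H¹(ι) x)_v⟩'_v = -⟨x_v, u_v⟩_v` (`exists_bidual_intertwining`,
`localTatePairingZMod_tateDual_map_bidual`); then `middleExact_of_dualMiddleExact`.  In particular the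
hypothesis `hE` of `exists_localInvariants_duality_of_middleExact_canonical` (all finite `M`) need only
be checked on one module of each pair `{M, M^D}`.
[cite: MilneADT2006, Ch. I, Thm. 4.10(b), Prop. 0.19 and Cor. 2.3] [cite: NeukirchSchmidtWingberg2008, I §4 (1.4.4)] -/
theorem middleExact_of_middleExact_tateDual [Finite (TateDual K M n)] (inv : LocalInvariants K n)
    (hperf : inv.IsPerfect) (hreal : inv.InjectiveAtRealPlaces) (ρ : DiscreteGaloisModule K M)
    (hM : ∀ m : M, n • m = 0)
    {S : Finset (Place K)}
    (hED : ∀ u : Π v : Place K, galoisCohomology ((ρ.tateDual n).toLocal v) 1,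
      (∀ z : galoisCohomology ((ρ.tateDual n).tateDual n) 1,
        (∀ v : HeightOneSpectrum (𝓞 K), (Sum.inr v : Place K) ∉ S →
          galoisCohomology.localization ((ρ.tateDual n).tateDual n) (Sum.inr v) 1 z ∈
            unramifiedSubgroup (GaloisRep.toLocal v ((ρ.tateDual n).tateDual n)) 1) →
        ∑ v ∈ S, localTatePairingZMod (ρ.tateDual n) n v (inv v) (u v)
          (galoisCohomology.localization ((ρ.tateDual n).tateDual n) v 1 z) = 0) →
      ∃ y : galoisCohomology (ρ.tateDual n) 1,
        (∀ v : HeightOneSpectrum (𝓞 K), (Sum.inr v : Place K) ∉ S →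
          galoisCohomology.localization (ρ.tateDual n) (Sum.inr v) 1 y ∈
            unramifiedSubgroup (GaloisRep.toLocal v (ρ.tateDual n)) 1) ∧
        ∀ v ∈ S, galoisCohomology.localization (ρ.tateDual n) v 1 y = u v)
    (t : Π v : Place K, galoisCohomology (ρ.toLocal v) 1)
    (horth : ∀ y : galoisCohomology (ρ.tateDual n) 1,
      (∀ v : HeightOneSpectrum (𝓞 K), (Sum.inr v : Place K) ∉ S →
        galoisCohomology.localization (ρ.tateDual n) (Sum.inr v) 1 y ∈
          unramifiedSubgroup (GaloisRep.toLocal v (ρ.tateDual n)) 1) →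
      ∑ v ∈ S, localTatePairingZMod ρ n v (inv v) (t v)
        (galoisCohomology.localization (ρ.tateDual n) v 1 y) = 0) :
    ∃ x : galoisCohomology ρ 1,
      (∀ v : HeightOneSpectrum (𝓞 K), (Sum.inr v : Place K) ∉ S →
        galoisCohomology.localization ρ (Sum.inr v) 1 x ∈ unramifiedSubgroup (GaloisRep.toLocal v ρ) 1) ∧
      ∀ v ∈ S, galoisCohomology.localization ρ v 1 x = t v := by
  haveI := DiscreteGaloisModule.TateDual.finite K (TateDual K M n) n
  obtain ⟨ι, κ, hι, hκι, hικ⟩ := exists_bidual_intertwining (n := n) ρ hM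
  refine middleExact_of_dualMiddleExact inv hperf hreal ρ hM (fun u hu => ?_) t horth
  -- the dual basic exactness for `(M, S)`: apply `hED` to `u`
  refine hED u fun z hz => ?_
  -- `z = H¹(ι) x` with `x = H¹(κ) z` unramified outside `S`
  set x : galoisCohomology ρ 1 := galoisCohomology.map κ 1 z with hx_def
  have hzx : galoisCohomology.map ι 1 x = z := Levels.map_map_eq_self_of_comp_eq κ ι hικ z
  have hx : ∀ v : HeightOneSpectrum (𝓞 K), (Sum.inr v : Place K) ∉ S →
      galoisCohomology.localization ρ (Sum.inr v) 1 x ∈ unramifiedSubgroup (GaloisRep.toLocal v ρ) 1 :=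
    fun v hv => by
      rw [hx_def, show galoisCohomology.localization ρ (Sum.inr v) 1 (galoisCohomology.map κ 1 z) =
        galoisCohomology.map (κ.restrictField (Place.Completion (Sum.inr v))) 1
          (galoisCohomology.localization ((ρ.tateDual n).tateDual n) (Sum.inr v) 1 z) from
        galoisCohomology.res_map_one _ κ z]
      exact Levels.map_mem_unramifiedSubgroup _ (hz v hv)
  have h0 := hu x hx
  rw [← hzx]
  have hterm : ∀ v ∈ S, localTatePairingZMod (ρ.tateDual n) n v (inv v) (u v)
      (galoisCohomology.localization ((ρ.tateDual n).tateDual n) v 1 (galoisCohomology.map ι 1 x)) =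
        -localTatePairingZMod ρ n v (inv v) (galoisCohomology.localization ρ v 1 x) (u v) := fun v _ => by
    rw [show galoisCohomology.localization ((ρ.tateDual n).tateDual n) v 1 (galoisCohomology.map ι 1 x) =
        galoisCohomology.map (ι.restrictField (Place.Completion v)) 1 (galoisCohomology.localization ρ v 1 x)
      from galoisCohomology.res_map_one _ ι x]
    exact localTatePairingZMod_tateDual_map_bidual ρ ι hι v (inv v) _ _
  rw [Finset.sum_congr rfl hterm, Finset.sum_neg_distrib, h0, neg_zero]

end TateDualToPrimal

/-! ## §3. THE invariant maps -/

section Canonical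

variable {K : Type} [Field K] [NumberField K] {n : ℕ} [NeZero n]
variable {M : Type} [AddCommGroup M] [TopologicalSpace M] [DiscreteTopology M] [Finite M]

/-- **For THE invariant maps `LocalInvariants.canonical K n`: the dual basic exactness `hE'(M, S)`
implies Milne I Thm. 4.10(b) `hE(M, S)`** (`middleExact_of_dualMiddleExact` with `canonical_isPerfect`,
`canonical_injectiveAtRealPlaces`). [cite: MilneADT2006, Ch. I, Thm. 4.10(b) and Prop. 0.19] -/
theorem middleExact_canonical_of_dualMiddleExact (ρ : DiscreteGaloisModule K M) (hM : ∀ m : M, n • m = 0)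
    {S : Finset (Place K)}
    (hE' : ∀ u : Π v : Place K, galoisCohomology ((ρ.tateDual n).toLocal v) 1,
      (∀ x : galoisCohomology ρ 1,
        (∀ v : HeightOneSpectrum (𝓞 K), (Sum.inr v : Place K) ∉ S →
          galoisCohomology.localization ρ (Sum.inr v) 1 x ∈ unramifiedSubgroup (GaloisRep.toLocal v ρ) 1) →
        ∑ v ∈ S, localTatePairingZMod ρ n v (LocalInvariants.canonical K n v)
          (galoisCohomology.localization ρ v 1 x) (u v) = 0) →
      ∃ y : galoisCohomology (ρ.tateDual n) 1,
        (∀ v : HeightOneSpectrum (𝓞 K), (Sum.inr v : Place K) ∉ S →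
          galoisCohomology.localization (ρ.tateDual n) (Sum.inr v) 1 y ∈
            unramifiedSubgroup (GaloisRep.toLocal v (ρ.tateDual n)) 1) ∧
        ∀ v ∈ S, galoisCohomology.localization (ρ.tateDual n) v 1 y = u v)
    (t : Π v : Place K, galoisCohomology (ρ.toLocal v) 1)
    (horth : ∀ y : galoisCohomology (ρ.tateDual n) 1,
      (∀ v : HeightOneSpectrum (𝓞 K), (Sum.inr v : Place K) ∉ S →
        galoisCohomology.localization (ρ.tateDual n) (Sum.inr v) 1 y ∈
          unramifiedSubgroup (GaloisRep.toLocal v (ρ.tateDual n)) 1) →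
      ∑ v ∈ S, localTatePairingZMod ρ n v (LocalInvariants.canonical K n v) (t v)
        (galoisCohomology.localization (ρ.tateDual n) v 1 y) = 0) :
    ∃ x : galoisCohomology ρ 1,
      (∀ v : HeightOneSpectrum (𝓞 K), (Sum.inr v : Place K) ∉ S →
        galoisCohomology.localization ρ (Sum.inr v) 1 x ∈ unramifiedSubgroup (GaloisRep.toLocal v ρ) 1) ∧
      ∀ v ∈ S, galoisCohomology.localization ρ v 1 x = t v :=
  middleExact_of_dualMiddleExact _ LocalInvariants.canonical_isPerfect
    LocalInvariants.canonical_injectiveAtRealPlaces ρ hM hE' t horth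

/-- **For THE invariant maps `LocalInvariants.canonical K n`: Milne I Thm. 4.10(b) `Ker γ¹ ⊆ Im β¹` for
`(M^D, S)` implies it for `(M, S)`** — the hypothesis `hE` of
`exists_localInvariants_duality_of_middleExact_canonical` /
`poitouTate_selmerStructure_duality_of_middleExact_canonical_primePow` need only be proved for one module
of each dual pair `{M, M^D}` (instance `[Finite (TateDual K M n)]`: `DiscreteGaloisModule.TateDual.finite K M n`).
[cite: MilneADT2006, Ch. I, Thm. 4.10(b), Prop. 0.19 and Cor. 2.3] -/
theorem middleExact_canonical_of_middleExact_tateDual [Finite (TateDual K M n)] (ρ : DiscreteGaloisModule K M)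
    (hM : ∀ m : M, n • m = 0) {S : Finset (Place K)}
    (hED : ∀ u : Π v : Place K, galoisCohomology ((ρ.tateDual n).toLocal v) 1,
      (∀ z : galoisCohomology ((ρ.tateDual n).tateDual n) 1,
        (∀ v : HeightOneSpectrum (𝓞 K), (Sum.inr v : Place K) ∉ S →
          galoisCohomology.localization ((ρ.tateDual n).tateDual n) (Sum.inr v) 1 z ∈
            unramifiedSubgroup (GaloisRep.toLocal v ((ρ.tateDual n).tateDual n)) 1) →
        ∑ v ∈ S, localTatePairingZMod (ρ.tateDual n) n v (LocalInvariants.canonical K n v) (u v)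
          (galoisCohomology.localization ((ρ.tateDual n).tateDual n) v 1 z) = 0) →
      ∃ y : galoisCohomology (ρ.tateDual n) 1,
        (∀ v : HeightOneSpectrum (𝓞 K), (Sum.inr v : Place K) ∉ S →
          galoisCohomology.localization (ρ.tateDual n) (Sum.inr v) 1 y ∈
            unramifiedSubgroup (GaloisRep.toLocal v (ρ.tateDual n)) 1) ∧
        ∀ v ∈ S, galoisCohomology.localization (ρ.tateDual n) v 1 y = u v)
    (t : Π v : Place K, galoisCohomology (ρ.toLocal v) 1)
    (horth : ∀ y : galoisCohomology (ρ.tateDual n) 1,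
      (∀ v : HeightOneSpectrum (𝓞 K), (Sum.inr v : Place K) ∉ S →
        galoisCohomology.localization (ρ.tateDual n) (Sum.inr v) 1 y ∈
          unramifiedSubgroup (GaloisRep.toLocal v (ρ.tateDual n)) 1) →
      ∑ v ∈ S, localTatePairingZMod ρ n v (LocalInvariants.canonical K n v) (t v)
        (galoisCohomology.localization (ρ.tateDual n) v 1 y) = 0) :
    ∃ x : galoisCohomology ρ 1,
      (∀ v : HeightOneSpectrum (𝓞 K), (Sum.inr v : Place K) ∉ S →
        galoisCohomology.localization ρ (Sum.inr v) 1 x ∈ unramifiedSubgroup (GaloisRep.toLocal v ρ) 1) ∧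
      ∀ v ∈ S, galoisCohomology.localization ρ v 1 x = t v :=
  middleExact_of_middleExact_tateDual _ LocalInvariants.canonical_isPerfect
    LocalInvariants.canonical_injectiveAtRealPlaces ρ hM hED t horth

end Canonical

end Summit.BirchSwinnertonDyer.BirchSwinnertonDyer.Theorems.SchneiderFreeAdditiveX3.PoitouTateReduction

end
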